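import Literature.AlgebraicGeometry.Modules.CechOrderedComplex
import Literature.AlgebraicGeometry.Motives.CartierDivisorCech
import HarnessLib

/-!
# The global sections of the ordered sheaf Čech complex of `𝒪_Y` are the ordered Čech complex of the
# family `s ↦ Γ(W_s, 𝒪_Y) ⊆ K(Y)` (Görtz–Wedhorn II, Def. 21.68 / (22.2))

Let `Y` be an INTEGRAL scheme, `pr : Y → B` a morphism and `𝔚 = (W_0, …, W_r)` a Čech cover of
`(pr, div 1)` over `B` (`Motives/CartierDivisorCech.CechCover` for the unit Cartier divisor `div 1`:
finitely many non-empty affine opens covering `Y`).  The tree carries TWO models of the ordered Čech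
complex `Č•_ord(𝔚, 𝒪_Y)`:

* the sheaf model `Modules/CechOrderedComplex` (seat core-qb): `CechOrd.complex 𝔚.W (unitModule Y)`,
  a cochain complex of `𝒪_Y`-modules indexed by `ℕ`, whose sections over `V` in degree `n` are the
  families `Cech.Sections (CechOrd.faces 𝔚.W n) 0 (unitModule Y) V = Π_{#s = n+1} Γ(𝒪_Y, V ∩ W_s)`
  with differential `CechOrd.d_app_apply_eq_sum_attach`;
* the function-field model `Motives/CartierDivisorCech`: `𝔚.complex`, the ordered Čech complex
  (`Algebra/Homology/OrderedCech`, indexed by `ℤ`) of the monotone family of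
  `Γ(B, 𝒪_B)`-submodules `𝔚.sectionsOn s = Γ(W_s, 𝒪_Y(div 1)) = {f ∈ K(Y) | f regular on W_s}` of
  `K(Y)`, for which the finiteness theorem `Hⁿ(𝔚.complex)` finitely generated (`pr` proper, `B` affine
  noetherian) is PROVED (`Motives/CechCoverProperFinite`).

This file identifies them on global sections: taking a section to its germ at the generic point
(`RatFn.ofSection`; `Γ(U, 𝒪_Y) = ⋂_{y ∈ U} 𝒪_{Y,y} ⊆ K(Y)`, Görtz–Wedhorn I, Prop. 3.29) is, degree by
degree, an additive bijection

  `CechCover.sectionsAddEquiv 𝔚 n : Cech.Sections (CechOrd.faces 𝔚.W n) 0 (unitModule Y) ⊤ ≃+ 𝔚.complex.X n`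

(`W_s`-regular rational functions are exactly the sections over `W_s`), and these bijections
intertwine the two differentials (`sectionsAddEquiv_d`: same faces, same signs
`(-1)^{#{b ∈ s | b < a}}`, restriction ↦ inclusion).  They also carry the action of a global function
`g ∈ Γ(Y, 𝒪_Y)` on sections to multiplication by its rational function (`sectionsAddEquiv_smul_top`),
which is how the base ring acts on both sides.  Everything is proved; no named facts.

## References

* U. Görtz, T. Wedhorn, *Algebraic Geometry II: Cohomology of Schemes* (2023), Def. 21.64, Def. 21.68
  (pp. 258–260), (22.2) (p. 332). [GortzWedhorn2023]
* U. Görtz, T. Wedhorn, *Algebraic Geometry I: Schemes*, 2nd ed. (2020), Prop. 3.29 (p. 102). [GortzWedhorn2020]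
-/

open CategoryTheory CategoryTheory.Limits AlgebraicGeometry TopologicalSpace Opposite

noncomputable section

namespace Literature.AlgebraicGeometry.Motives

open RatFn Literature.Algebra.Homology Literature.AlgebraicGeometry.Modules

namespace CartierDivisor.CechCover

-- Universe `0`: the sheaf Čech complex of `Modules/CechObjects` indexes covers by a type in the universe of
-- the scheme, and a Čech cover is indexed by `Fin (r + 1) : Type`; this is the universe of the consumer
-- (`GortzWedhorn2023_cohomology_proper_coherent_finite`, fields `k : Type`).
variable {Y B : Scheme.{0}} [IsIntegral Y] {pr : Y ⟶ B}
  (𝔚 : CechCover pr ⊤ (CartierDivisor.principal (X := Y) 1 one_ne_zero))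

/-! ### Indices: `CechOrd.Idx` versus `OrderedCech.Simplex` -/

/-- The ordered-Čech index (`Fin 1 → {s // #s = n+1}`) of a simplex `{s // s ≠ ∅ ∧ #s = n+1}`.
[cite: GortzWedhorn2023, Def. 21.68 (p. 260)] -/
def idxOf {n : ℕ} (σ : OrderedCech.Simplex (Fin (𝔚.r + 1)) (n : ℤ)) : CechOrd.Idx (Fin (𝔚.r + 1)) n :=
  fun _ => ⟨σ.1, by have := σ.2.2; omega⟩

/-- The simplex of an ordered-Čech index. [cite: GortzWedhorn2023, Def. 21.68 (p. 260)] -/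
def simplexOf {n : ℕ} (β : CechOrd.Idx (Fin (𝔚.r + 1)) n) : OrderedCech.Simplex (Fin (𝔚.r + 1)) (n : ℤ) :=
  ⟨(β 0).1, Finset.card_pos.1 (by rw [(β 0).2]; omega), by rw [(β 0).2]; push_cast; ring⟩

/-- The underlying set of `idxOf σ` is that of `σ`. [cite: GortzWedhorn2023, Def. 21.68 (p. 260)] -/
@[simp] lemma idxOf_zero_val {n : ℕ} (σ : OrderedCech.Simplex (Fin (𝔚.r + 1)) (n : ℤ)) :
    (𝔚.idxOf σ 0).1 = σ.1 := rfl

/-- The underlying set of `simplexOf β` is that of `β 0`. [cite: GortzWedhorn2023, Def. 21.68 (p. 260)] -/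
@[simp] lemma simplexOf_val {n : ℕ} (β : CechOrd.Idx (Fin (𝔚.r + 1)) n) : (𝔚.simplexOf β).1 = (β 0).1 := rfl

/-- `idxOf ∘ simplexOf = id`. [cite: GortzWedhorn2023, Def. 21.68 (p. 260)] -/
lemma idxOf_simplexOf {n : ℕ} (β : CechOrd.Idx (Fin (𝔚.r + 1)) n) : 𝔚.idxOf (𝔚.simplexOf β) = β :=
  CechOrd.Idx.ext rfl

/-- `simplexOf ∘ idxOf = id`. [cite: GortzWedhorn2023, Def. 21.68 (p. 260)] -/
lemma simplexOf_idxOf {n : ℕ} (σ : OrderedCech.Simplex (Fin (𝔚.r + 1)) (n : ℤ)) :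
    𝔚.simplexOf (𝔚.idxOf σ) = σ :=
  Subtype.ext rfl

/-! ### The opens: `⊤ ∩ U_{β}` versus `W_s` -/

/-- `⊤ ∩ (⋂_{i ∈ s} W_i) ⊆ W_s = pr⁻¹⊤ ∩ ⋂_{i ∈ s} W_i`. [cite: GortzWedhorn2023, Def. 21.64 (p. 258)] -/
lemma top_inf_face_le {n : ℕ} (β : CechOrd.Idx (Fin (𝔚.r + 1)) n) :
    ⊤ ⊓ face (CechOrd.faces 𝔚.W n) β ≤ 𝔚.opens (β 0).1 := by
  rw [CechOrd.face_faces]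
  refine inf_le_right.trans (le_inf ?_ (Finset.le_inf fun a ha => CechOrd.faceSet_le ha))
  rw [Scheme.Hom.preimage_top]; exact le_top

/-- `W_s ⊆ ⊤ ∩ (⋂_{i ∈ s} W_i)`. [cite: GortzWedhorn2023, Def. 21.64 (p. 258)] -/
lemma opens_le_top_inf_face {n : ℕ} (β : CechOrd.Idx (Fin (𝔚.r + 1)) n) :
    𝔚.opens (β 0).1 ≤ ⊤ ⊓ face (CechOrd.faces 𝔚.W n) β := by
  rw [CechOrd.face_faces]
  exact le_inf le_top (le_iInf₂ fun i hi => 𝔚.opens_le_W hi)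

/-- The generic point lies in every `⊤ ∩ U_β`. [cite: GortzWedhorn2020, Prop. 3.29 (p. 102)] -/
lemma genericPoint_mem_top_inf_face {n : ℕ} (β : CechOrd.Idx (Fin (𝔚.r + 1)) n) :
    genericPoint Y ∈ ⊤ ⊓ face (CechOrd.faces 𝔚.W n) β :=
  𝔚.opens_le_top_inf_face β (𝔚.genericPoint_mem_opens _)

/-! ### One component: sections over `⊤ ∩ U_β` versus rational functions regular on `W_s` -/

/-- The rational function of a section of `𝒪_Y` over `⊤ ∩ U_β` (germ at the generic point).
[cite: GortzWedhorn2020, Prop. 3.29 (p. 102)] -/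
def toK {n : ℕ} (β : CechOrd.Idx (Fin (𝔚.r + 1)) n)
    (x : Γ(unitModule Y, ⊤ ⊓ face (CechOrd.faces 𝔚.W n) β)) : Y.functionField :=
  ofSection (𝔚.genericPoint_mem_top_inf_face β) (x : Γ(Y, ⊤ ⊓ face (CechOrd.faces 𝔚.W n) β))

/-- `toK` is additive (the germ map is a ring homomorphism). [cite: GortzWedhorn2020, Prop. 3.29 (p. 102)] -/
lemma toK_add {n : ℕ} (β : CechOrd.Idx (Fin (𝔚.r + 1)) n)
    (x y : Γ(unitModule Y, ⊤ ⊓ face (CechOrd.faces 𝔚.W n) β)) :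
    𝔚.toK β (x + y) = 𝔚.toK β x + 𝔚.toK β y :=
  map_add (Y.presheaf.germ _ (genericPoint Y) (𝔚.genericPoint_mem_top_inf_face β)).hom _ _

/-- `toK 0 = 0`. [cite: GortzWedhorn2020, Prop. 3.29 (p. 102)] -/
lemma toK_zero {n : ℕ} (β : CechOrd.Idx (Fin (𝔚.r + 1)) n) :
    𝔚.toK β (0 : Γ(unitModule Y, ⊤ ⊓ face (CechOrd.faces 𝔚.W n) β)) = 0 :=
  map_zero (Y.presheaf.germ _ (genericPoint Y) (𝔚.genericPoint_mem_top_inf_face β)).hom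

/-- Components at equal indices have the same rational function. [cite: GortzWedhorn2023, Def. 21.68 (p. 260)] -/
lemma toK_congr {n : ℕ} {β γ : CechOrd.Idx (Fin (𝔚.r + 1)) n} (e : β = γ)
    (c : Cech.Sections (CechOrd.faces 𝔚.W n) 0 (unitModule Y) ⊤) : 𝔚.toK β (c β) = 𝔚.toK γ (c γ) := by
  subst e; rfl

/-- `toK` as an additive monoid homomorphism. [cite: GortzWedhorn2020, Prop. 3.29 (p. 102)] -/
def toKHom {n : ℕ} (β : CechOrd.Idx (Fin (𝔚.r + 1)) n) :
    Γ(unitModule Y, ⊤ ⊓ face (CechOrd.faces 𝔚.W n) β) →+ Y.functionField where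
  toFun := 𝔚.toK β
  map_zero' := 𝔚.toK_zero β
  map_add' := 𝔚.toK_add β

/-- `toKHom` is `toK`. [cite: GortzWedhorn2020, Prop. 3.29 (p. 102)] -/
@[simp] lemma toKHom_apply {n : ℕ} (β : CechOrd.Idx (Fin (𝔚.r + 1)) n)
    (x : Γ(unitModule Y, ⊤ ⊓ face (CechOrd.faces 𝔚.W n) β)) : 𝔚.toKHom β x = 𝔚.toK β x := rfl

/-- Restriction does not change the rational function. [cite: GortzWedhorn2020, Prop. 3.29 (p. 102)] -/
lemma toK_res {m n : ℕ} (β : CechOrd.Idx (Fin (𝔚.r + 1)) m) (γ : CechOrd.Idx (Fin (𝔚.r + 1)) n)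
    (h : ⊤ ⊓ face (CechOrd.faces 𝔚.W n) γ ≤ ⊤ ⊓ face (CechOrd.faces 𝔚.W m) β)
    (x : Γ(unitModule Y, ⊤ ⊓ face (CechOrd.faces 𝔚.W m) β)) :
    𝔚.toK γ (Cech.res (unitModule Y) h x) = 𝔚.toK β x :=
  ofSection_map (homOfLE h) (𝔚.genericPoint_mem_top_inf_face γ) _

/-- `toK` is injective (`Y` integral: sections are determined by their germ at the generic point).
[cite: GortzWedhorn2020, Prop. 3.29 (2) (p. 102)] -/
lemma toK_injective {n : ℕ} (β : CechOrd.Idx (Fin (𝔚.r + 1)) n) : Function.Injective (𝔚.toK β) := by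
  haveI : Nonempty (⊤ ⊓ face (CechOrd.faces 𝔚.W n) β : Y.Opens) :=
    ⟨⟨_, 𝔚.genericPoint_mem_top_inf_face β⟩⟩
  intro x y h
  exact Y.germToFunctionField_injective (⊤ ⊓ face (CechOrd.faces 𝔚.W n) β) h

/-- The rational function of a section over `⊤ ∩ U_β` is regular on `W_s`, i.e. lies in
`Γ(W_s, 𝒪_Y(div 1))`. [cite: GortzWedhorn2020, Prop. 3.29 (3) (p. 102)] -/
lemma toK_mem {n : ℕ} (β : CechOrd.Idx (Fin (𝔚.r + 1)) n)
    (x : Γ(unitModule Y, ⊤ ⊓ face (CechOrd.faces 𝔚.W n) β)) :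
    letI := CartierDivisor.baseAlgebra pr ⊤ 𝔚.genericPoint_mem
    𝔚.toK β x ∈ 𝔚.sectionsOn (β 0).1 := by
  letI := CartierDivisor.baseAlgebra pr ⊤ 𝔚.genericPoint_mem
  rw [mem_sectionsOn_iff]
  refine (CartierDivisor.isSectionOn_iff_of_le (D := CartierDivisor.principal (X := Y) 1 one_ne_zero)
    (W := 𝔚.opens (β 0).1) (i := PUnit.unit) le_top).2 fun y hy => ?_
  rw [show (CartierDivisor.principal (X := Y) 1 one_ne_zero).f PUnit.unit = 1 from rfl, one_mul]
  exact isRegularAt_ofSection (𝔚.opens_le_top_inf_face β hy) _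

/-- Every rational function regular on `W_s` is the rational function of a unique section over
`⊤ ∩ U_β` (`Γ(U, 𝒪_Y) = ⋂_{y ∈ U} 𝒪_{Y,y}`). [cite: GortzWedhorn2020, Prop. 3.29 (3) (p. 102)] -/
lemma toK_surjective_of_mem {n : ℕ} (β : CechOrd.Idx (Fin (𝔚.r + 1)) n) {f : Y.functionField}
    (hf : letI := CartierDivisor.baseAlgebra pr ⊤ 𝔚.genericPoint_mem; f ∈ 𝔚.sectionsOn (β 0).1) :
    ∃ x : Γ(unitModule Y, ⊤ ⊓ face (CechOrd.faces 𝔚.W n) β), 𝔚.toK β x = f := by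
  letI := CartierDivisor.baseAlgebra pr ⊤ 𝔚.genericPoint_mem
  rw [mem_sectionsOn_iff, CartierDivisor.isSectionOn_iff_of_le
    (D := CartierDivisor.principal (X := Y) 1 one_ne_zero) (W := 𝔚.opens (β 0).1) (i := PUnit.unit)
    le_top] at hf
  have hf' : ∀ y ∈ (⊤ ⊓ face (CechOrd.faces 𝔚.W n) β : Y.Opens), IsRegularAt y f := fun y hy => by
    have := hf y (𝔚.top_inf_face_le β hy)
    rwa [show (CartierDivisor.principal (X := Y) 1 one_ne_zero).f PUnit.unit = 1 from rfl, one_mul] at this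
  obtain ⟨σ, hσ⟩ := exists_germ_eq_of_forall_isRegularAt (𝔚.genericPoint_mem_top_inf_face β) hf'
  exact ⟨σ, hσ⟩

/-! ### The cochain bijections -/

/-- The cochain of rational functions of a family of sections. [cite: GortzWedhorn2023, Def. 21.68 (p. 260)] -/
def toCochain (n : ℕ) (c : Cech.Sections (CechOrd.faces 𝔚.W n) 0 (unitModule Y) ⊤) :
    letI := CartierDivisor.baseAlgebra pr ⊤ 𝔚.genericPoint_mem
    OrderedCech.Cochain 𝔚.sectionsOn (n : ℤ) :=
  fun σ => ⟨𝔚.toK (𝔚.idxOf σ) (c (𝔚.idxOf σ)), 𝔚.toK_mem (𝔚.idxOf σ) (c (𝔚.idxOf σ))⟩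

/-- Components of `toCochain` in `K(Y)`. [cite: GortzWedhorn2023, Def. 21.68 (p. 260)] -/
@[simp] lemma coe_toCochain_apply (n : ℕ) (c : Cech.Sections (CechOrd.faces 𝔚.W n) 0 (unitModule Y) ⊤)
    (σ : OrderedCech.Simplex (Fin (𝔚.r + 1)) (n : ℤ)) :
    letI := CartierDivisor.baseAlgebra pr ⊤ 𝔚.genericPoint_mem
    ((𝔚.toCochain n c σ : 𝔚.sectionsOn σ.1) : Y.functionField) = 𝔚.toK (𝔚.idxOf σ) (c (𝔚.idxOf σ)) :=
  rfl

/-- `toCochain 0 = 0`. [cite: GortzWedhorn2023, Def. 21.68 (p. 260)] -/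
lemma toCochain_zero (n : ℕ) : 𝔚.toCochain n 0 = 0 :=
  funext fun _ => Subtype.ext (𝔚.toK_zero _)

/-- `toCochain` is additive. [cite: GortzWedhorn2023, Def. 21.68 (p. 260)] -/
lemma toCochain_add (n : ℕ) (c c' : Cech.Sections (CechOrd.faces 𝔚.W n) 0 (unitModule Y) ⊤) :
    𝔚.toCochain n (c + c') = 𝔚.toCochain n c + 𝔚.toCochain n c' :=
  funext fun _ => Subtype.ext (𝔚.toK_add _ _ _)

/-- `toCochain` is injective (`Y` integral). [cite: GortzWedhorn2020, Prop. 3.29 (2) (p. 102)] -/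
lemma toCochain_injective (n : ℕ) : Function.Injective (𝔚.toCochain n) := by
  intro c c' h
  funext β
  have hβ := congrArg (fun g => ((g (𝔚.simplexOf β) : 𝔚.sectionsOn (𝔚.simplexOf β).1) : Y.functionField)) h
  simp only [coe_toCochain_apply] at hβ
  rw [𝔚.toK_congr (𝔚.idxOf_simplexOf β) c, 𝔚.toK_congr (𝔚.idxOf_simplexOf β) c'] at hβ
  exact 𝔚.toK_injective β hβ

/-- `toCochain` is surjective (`Γ(U, 𝒪_Y) = ⋂_{y ∈ U} 𝒪_{Y,y}`). [cite: GortzWedhorn2020, Prop. 3.29 (3) (p. 102)] -/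
lemma toCochain_surjective (n : ℕ) : Function.Surjective (𝔚.toCochain n) := by
  letI := CartierDivisor.baseAlgebra pr ⊤ 𝔚.genericPoint_mem
  intro g
  choose x hx using fun β : CechOrd.Idx (Fin (𝔚.r + 1)) n =>
    𝔚.toK_surjective_of_mem β (f := (g (𝔚.simplexOf β) : Y.functionField)) (g (𝔚.simplexOf β)).2
  refine ⟨x, funext fun σ => Subtype.ext ?_⟩
  rw [coe_toCochain_apply, hx, simplexOf_idxOf]

/-- **Degree-`n` cochains agree**: `Π_β Γ(𝒪_Y, ⊤ ∩ U_β) ≃+ Π_{#s = n+1} Γ(W_s, 𝒪_Y(div 1))`, a section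
going to its rational function. [cite: GortzWedhorn2023, Def. 21.68 (p. 260)] [cite: GortzWedhorn2020, Prop. 3.29 (p. 102)] -/
def sectionsAddEquiv (n : ℕ) :
    letI := CartierDivisor.baseAlgebra pr ⊤ 𝔚.genericPoint_mem
    Cech.Sections (CechOrd.faces 𝔚.W n) 0 (unitModule Y) ⊤ ≃+ OrderedCech.Cochain 𝔚.sectionsOn (n : ℤ) :=
  letI := CartierDivisor.baseAlgebra pr ⊤ 𝔚.genericPoint_mem
  AddEquiv.ofBijective (AddMonoidHom.mk' (𝔚.toCochain n) (𝔚.toCochain_add n))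
    ⟨𝔚.toCochain_injective n, 𝔚.toCochain_surjective n⟩

/-- `sectionsAddEquiv` is `toCochain`. [cite: GortzWedhorn2023, Def. 21.68 (p. 260)] -/
@[simp] lemma sectionsAddEquiv_apply (n : ℕ) (c : Cech.Sections (CechOrd.faces 𝔚.W n) 0 (unitModule Y) ⊤) :
    𝔚.sectionsAddEquiv n c = 𝔚.toCochain n c := rfl

/-! ### Compatibility with the differentials -/

/-- Integer signs act on `K(Y)` through the base ring: `((-1)^m : A) • f = ((-1)^m : ℤ) • f`. [folklore] -/
private lemma sign_smul_eq_sgn_smul (s : Finset (Fin (𝔚.r + 1))) (a : Fin (𝔚.r + 1)) (f : Y.functionField) :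
    letI := CartierDivisor.baseAlgebra pr ⊤ 𝔚.genericPoint_mem
    OrderedCech.sign Γ(B, ⊤) s a • f = CechOrd.sgn s a • f := by
  letI := CartierDivisor.baseAlgebra pr ⊤ 𝔚.genericPoint_mem
  unfold OrderedCech.sign CechOrd.sgn
  rw [← Int.cast_smul_eq_zsmul Γ(B, ⊤), Int.cast_pow, Int.cast_neg, Int.cast_one]

/-- **The bijections intertwine the differentials**: the rational function of
`(d c)_t = Σ_{a ∈ t} ε(t, a) c_{t ∖ a}|_{W_t}` is `Σ_{a ∈ t} ε(t, a) · (rational function of c_{t ∖ a})`,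
the ordered Čech differential of `Algebra/Homology/OrderedCech`. [cite: GortzWedhorn2023, Def. 21.68 (p. 260)] -/
theorem sectionsAddEquiv_d (n : ℕ) (c : Cech.Sections (CechOrd.faces 𝔚.W n) 0 (unitModule Y) ⊤) :
    letI := CartierDivisor.baseAlgebra pr ⊤ 𝔚.genericPoint_mem
    𝔚.sectionsAddEquiv (n + 1) ((CechOrd.d 𝔚.W (unitModule Y) n).app ⊤ c) =
      OrderedCech.d 𝔚.sectionsOn 𝔚.sectionsOn_mono (n : ℤ) (𝔚.sectionsAddEquiv n c) := by
  letI := CartierDivisor.baseAlgebra pr ⊤ 𝔚.genericPoint_mem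
  funext σ
  apply Subtype.ext
  rw [sectionsAddEquiv_apply, sectionsAddEquiv_apply, coe_toCochain_apply, OrderedCech.coe_d_apply,
    CechOrd.d_app_apply_eq_sum_attach]
  -- left: the rational function of a signed sum of restrictions
  rw [show 𝔚.toK (𝔚.idxOf σ) = 𝔚.toKHom (𝔚.idxOf σ) from rfl, map_sum]
  rw [← Finset.sum_attach σ.1]
  refine Finset.sum_congr rfl fun a _ => ?_
  rw [map_zsmul, toKHom_apply, 𝔚.toK_res, ← sign_smul_eq_sgn_smul]
  congr 1
  -- right: `ext0` at the face `σ ∖ a`, an `n`-simplex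
  have hmem : (a : Fin (𝔚.r + 1)) ∈ σ.1 := a.2
  have hcardN : (σ.1.erase a).card = n + 1 := by
    have h1 : (σ.1.erase a).card = σ.1.card - 1 := Finset.card_erase_of_mem hmem
    have h2 : σ.1.card = n + 2 := by have := σ.2.2; omega
    omega
  have hcard : ((σ.1.erase a).card : ℤ) = n + 1 := by rw [hcardN]; push_cast; ring
  have hne : (σ.1.erase a).Nonempty := Finset.card_pos.1 (by omega)
  rw [show σ.1.erase a = (⟨σ.1.erase a, hne, hcard⟩ : OrderedCech.Simplex (Fin (𝔚.r + 1)) (n : ℤ)).1 from rfl,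
    OrderedCech.Cochain.ext0_val, coe_toCochain_apply]
  rfl

/-! ### Global functions act alike on both sides -/

/-- The rational function of `g|_{⊤ ∩ U_β} • x` is `(rational function of g) · (rational function of x)`.
[cite: GortzWedhorn2020, Prop. 3.29 (p. 102)] -/
lemma toK_smul_top {n : ℕ} (β : CechOrd.Idx (Fin (𝔚.r + 1)) n) (g : Γ(Y, ⊤))
    (x : Γ(unitModule Y, ⊤ ⊓ face (CechOrd.faces 𝔚.W n) β)) :
    𝔚.toK β (Cech.resO (X := Y) (inf_le_left : ⊤ ⊓ face (CechOrd.faces 𝔚.W n) β ≤ ⊤) g • x) =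
      ofSection (show genericPoint Y ∈ (⊤ : Y.Opens) from trivial) g * 𝔚.toK β x := by
  unfold toK
  rw [← ofSection_map (homOfLE (inf_le_left : ⊤ ⊓ face (CechOrd.faces 𝔚.W n) β ≤ ⊤))
    (𝔚.genericPoint_mem_top_inf_face β) g]
  exact map_mul (Y.presheaf.germ _ (genericPoint Y) (𝔚.genericPoint_mem_top_inf_face β)).hom _ _

end CartierDivisor.CechCover

end Literature.AlgebraicGeometry.Motives

end
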